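import Summits.AtomisticToContinuum.FouriersLaw.Theorems.HiddenChargeMazurOddChargeAlgebraToolkitB
import Summits.AtomisticToContinuum.FouriersLaw.Theorems.HiddenChargeMazurOddChargeAlgebraToolkitC

/-!
# Odd conservation laws of the pinned anharmonic chain — core recursion: endgame and clash

File CORE2 of the negative edge of crux `HiddenChargeMazur.OddChargeExists`
(item stmt-AtomisticToContinuum-13511): the last transport step `a_{D-2} ↦ a_{D-1}` of the
leading-order recursion (`core_step_last`), the clash at `y = D` — the forced leading family
violates the last transport equation by `2D·c·Φ_L·γ_{D-1}·Π_{[1,D-1)}·q_{D+1}·clashQuad D ≠ 0`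
(`core_clash_of_last`) — and the span `D = 1` (`core_clash_one`).
Elementary polynomial algebra in `MvPolynomial (ℤ ⊕ ℤ) ℝ`. [folklore]
-/

noncomputable section

open MvPolynomial Finsupp
open scoped BigOperators

namespace Summit.AtomisticToContinuum.FouriersLaw.Theorems.OddChargeAlgebra

/-! ### Local toolkit -/

/-- `∂_{q_i} q_j = 0` for `j ≠ i`. [folklore] -/
private theorem pd_X_ne {i j : ℤ} (h : j ≠ i) : pderiv (Sum.inl i) (X (Sum.inl j) : R) = 0 :=
  pderiv_inl_X_inl_of_ne (Ne.symm h)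

/-- Chain rule for `cub`. [folklore] -/
private theorem pd_cub (v : Var) (a b : R) :
    pderiv v (cub a b) = (3 * a ^ 2 - 6 * a * b + 3 * b ^ 2) * pderiv v a
      + (6 * a * b - 3 * a ^ 2) * pderiv v b := by
  unfold cub
  simp only [map_add, map_sub, pderiv_mul, pderiv_pow, pderiv_ofNat]
  push_cast
  ring

/-- `∂_{q_{j+1}} γ_j = -1`. [folklore] -/
private theorem pd_gam_succ {i j : ℤ} (h : i = j + 1) : pderiv (Sum.inl i) (gam j) = -1 := by
  subst h
  exact pderiv_inl_gam_succ j

/-- `∂_{q_i} γ_j = 0` for `i ∉ {j, j+1}`. [folklore] -/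
private theorem pd_gam_ne {i j : ℤ} (h1 : j ≠ i) (h2 : j + 1 ≠ i) :
    pderiv (Sum.inl i) (gam j) = 0 :=
  pderiv_inl_gam_of_ne (Ne.symm h1) (Ne.symm h2)

/-- Splitting off the bottom factor of `prodsq (Ico a b)`. [folklore] -/
private theorem prodsq_Ico_bot {a b : ℤ} (h : a < b) :
    prodsq (Finset.Ico a b) = gam a ^ 2 * prodsq (Finset.Ico (a + 1) b) := by
  rw [← Finset.insert_Ico_add_one_left_eq_Ico h, prodsq_insert (by simp)]

/-- Integration tool: equal `∂_v`-derivatives and equal restrictions to `X v = 0` force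
equality. [folklore] -/
private theorem eq_of_pderiv_eq_of_killVar_eq {v : Var} {P Q : R}
    (h1 : pderiv v P = pderiv v Q) (h2 : killVar v P = killVar v Q) : P = Q :=
  sub_eq_zero.mp (eq_zero_of_pderiv_of_killVar (by rw [map_sub, h1, sub_self])
    (by rw [map_sub, h2, sub_self]))

/-- `C (1/3) * 3 = 1`. [folklore] -/
private theorem C13_mul_three : (C (1 / 3 : ℝ) : R) * 3 = 1 := by
  rw [← map_ofNat C 3, ← map_mul]; norm_num

/-- `C (x/3) = C x * C (1/3)`. [folklore] -/
private theorem C_div_three (x : ℝ) : (C (x / 3) : R) = C x * C (1 / 3) := by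
  rw [← map_mul, ← div_eq_mul_one_div]

/-- Removing a factor `C (1/3)`. [folklore] -/
private theorem third_trick {A E : R} (h : A = 3 * E) : C (1 / 3 : ℝ) * A = E := by
  rw [h, ← mul_assoc, C13_mul_three, one_mul]

/-! ### The last transport step `a_{D-2} ↦ a_{D-1}` (`D ≥ 4`) -/

/-- `S ∂_0 (c · leadMid D (D-2))`. [folklore] -/
private theorem last_e1 {D : ℤ} (hD : 4 ≤ D) (c : ℝ) :
    shift (pderiv (Sum.inl 0) (C c * leadMid D (D - 2)))
      = C c * (gam 1 ^ 2 * cub (X (Sum.inl (D + 1))) (X (Sum.inl D)) * gam (D - 2) * gam (D - 1)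
          * (C ((4 * D - 6 : ℤ) : ℝ) * gam (D - 2) - C ((4 * D - 10 : ℤ) : ℝ) * gam (D - 1))
          * prodsq (Finset.Ico 2 (D - 2))) := by
  unfold leadMid
  simp only [show D - 2 - 1 = D - 3 by omega, show D - 2 + 1 = D - 1 by omega, Finset.Ico_self,
    prodsq_empty, mul_one]
  simp only [pderiv_mul, pderiv_C, map_sub, pd_cub, pderiv_X_self,
    pd_X_ne (show (1 : ℤ) ≠ 0 by omega), pd_X_ne (show D ≠ 0 by omega),
    pd_X_ne (show D - 1 ≠ 0 by omega),
    pd_gam_ne (show D - 3 ≠ 0 by omega) (show D - 3 + 1 ≠ 0 by omega),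
    pd_gam_ne (show D - 2 ≠ 0 by omega) (show D - 2 + 1 ≠ 0 by omega),
    pderiv_inl_prodsq_eq_zero (show (0 : ℤ) ∉ Finset.Ico 1 (D - 3) by simp)
      (show (0 : ℤ) - 1 ∉ Finset.Ico 1 (D - 3) by simp),
    mul_zero, zero_mul, add_zero, sub_zero, zero_add, mul_one]
  simp only [map_mul, map_sub, map_add, map_pow, map_ofNat, shift_C, shift_X_inl, shift_gam,
    shift_cub, shift_prodsq_Ico, show D - 3 + 1 = D - 2 by omega, show D - 2 + 1 = D - 1 by omega,
    show D - 1 + 1 = D by omega, show (0 : ℤ) + 1 = 1 by omega, show (1 : ℤ) + 1 = 2 by omega]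
  congr 1
  apply third_trick
  simp only [gam, cub, map_intCast, show (1 : ℤ) + 1 = 2 by omega,
    show D - 2 + 1 = D - 1 by omega, show D - 1 + 1 = D by omega]
  push_cast
  ring

/-- `S ∂_{D-2} (c · lead0 D)`. [folklore] -/
private theorem last_e2 {D : ℤ} (hD : 4 ≤ D) (c : ℝ) :
    shift (pderiv (Sum.inl (D - 2)) (C c * lead0 D))
      = C c * (cub (X (Sum.inl (D + 1))) (X (Sum.inl D)) * prodsq (Finset.Ico 1 (D - 2))
          * (2 * gam (D - 2) * gam (D - 1) * (gam (D - 2) - gam (D - 1)))) := by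
  have hs : prodsq (Finset.Ico 0 (D - 1))
      = prodsq (Finset.Ico 0 (D - 3)) * gam (D - 3) ^ 2 * gam (D - 2) ^ 2 := by
    rw [show D - 1 = D - 2 + 1 by omega, prodsq_Ico_succ (by omega),
      show D - 2 = D - 3 + 1 by omega, prodsq_Ico_succ (by omega)]
  unfold lead0
  rw [hs]
  simp only [pderiv_mul, pderiv_C, pderiv_pow, pd_cub,
    pd_X_ne (show D ≠ D - 2 by omega), pd_X_ne (show D - 1 ≠ D - 2 by omega),
    pd_gam_succ (show D - 2 = D - 3 + 1 by omega), pderiv_inl_gam_self,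
    pderiv_inl_prodsq_eq_zero (show D - 2 ∉ Finset.Ico 0 (D - 3) by simp)
      (show D - 2 - 1 ∉ Finset.Ico 0 (D - 3) by simp only [Finset.mem_Ico]; omega),
    mul_zero, zero_mul, add_zero, zero_add, mul_one]
  simp only [map_mul, map_add, map_neg, map_pow, map_natCast, map_one,
    shift_C, shift_X_inl, shift_gam, shift_cub, shift_prodsq_Ico, show D - 3 + 1 = D - 2 by omega,
    show D - 2 + 1 = D - 1 by omega, show D - 1 + 1 = D by omega, show (0 : ℤ) + 1 = 1 by omega]
  push_cast
  ring

/-- `∂_{D-1} (c · leadD D)`. [folklore] -/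
private theorem last_e3 {D : ℤ} (hD : 4 ≤ D) (c : ℝ) :
    pderiv (Sum.inl (D - 1)) (C c * leadD D)
      = -(C c * (cub (X (Sum.inl 0)) (X (Sum.inl 1)) * prodsq (Finset.Ico 1 (D - 2))
          * (2 * gam (D - 2) * gam (D - 1) * (gam (D - 2) - gam (D - 1))))) := by
  have hs : prodsq (Finset.Ico 1 D)
      = prodsq (Finset.Ico 1 (D - 2)) * gam (D - 2) ^ 2 * gam (D - 1) ^ 2 := by
    rw [← prodsq_Ico_succ (show (1 : ℤ) ≤ D - 2 by omega), show D - 2 + 1 = D - 1 by omega,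
      ← prodsq_Ico_succ (show (1 : ℤ) ≤ D - 1 by omega), sub_add_cancel]
  unfold leadD
  rw [hs]
  simp only [pderiv_mul, pderiv_C, map_neg, pderiv_pow, pd_cub,
    pd_X_ne (show (0 : ℤ) ≠ D - 1 by omega), pd_X_ne (show (1 : ℤ) ≠ D - 1 by omega),
    pd_gam_succ (show D - 1 = D - 2 + 1 by omega), pderiv_inl_gam_self,
    pderiv_inl_prodsq_eq_zero (show D - 1 ∉ Finset.Ico 1 (D - 2) by simp)
      (show D - 1 - 1 ∉ Finset.Ico 1 (D - 2) by simp only [Finset.mem_Ico]; omega),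
    mul_zero, zero_mul, add_zero, zero_add, mul_one]
  push_cast
  ring

/-- `∂_D (c · leadLast D)`. [folklore] -/
private theorem last_e4 {D : ℤ} (hD : 4 ≤ D) (c : ℝ) :
    pderiv (Sum.inl D) (C c * leadLast D)
      = C c * (cub (X (Sum.inl 0)) (X (Sum.inl 1)) * prodsq (Finset.Ico 1 (D - 2)) * gam (D - 2)
          * gam (D - 1) * (C ((4 * D - 2 : ℤ) : ℝ) * gam (D - 2)
            - C ((4 * D - 6 : ℤ) : ℝ) * gam (D - 1))) := by
  unfold leadLast
  rw [C_div_three]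
  simp only [pderiv_mul, pderiv_C, map_sub, map_add, pderiv_pow, pd_cub, pderiv_X_self,
    pd_X_ne (show (0 : ℤ) ≠ D by omega), pd_X_ne (show (1 : ℤ) ≠ D by omega),
    pd_X_ne (show D - 1 ≠ D by omega), pd_X_ne (show D - 2 ≠ D by omega),
    pd_gam_ne (show D - 2 ≠ D by omega) (show D - 2 + 1 ≠ D by omega),
    pderiv_inl_prodsq_eq_zero (show D ∉ Finset.Ico 1 (D - 2) by simp)
      (show D - 1 ∉ Finset.Ico 1 (D - 2) by simp),
    mul_zero, zero_mul, add_zero, sub_zero, zero_add, mul_one]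
  simp only [gam, map_intCast, show D - 2 + 1 = D - 1 by omega, show D - 1 + 1 = D by omega]
  push_cast
  linear_combination (-(C c * cub (X (Sum.inl 0)) (X (Sum.inl 1))
    * (X (Sum.inl (D - 2)) - X (Sum.inl (D - 1))) * prodsq (Finset.Ico 1 (D - 2))
    * ((4 * (D : R) - 6) * X (Sum.inl D) ^ 2))) * C13_mul_three

/-- `c · leadLast D` vanishes on `q_D = 0`. [folklore] -/
private theorem last_k4 (D : ℤ) (c : ℝ) : killVar (Sum.inl D) (C c * leadLast D) = 0 := by
  unfold leadLast
  simp only [map_mul, killVar_X_self, mul_zero, zero_mul]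

/-- THE LAST TRANSPORT STEP (`D ≥ 4`): `a_{D-2} = c · leadMid D (D-2)` forces
`a_{D-1} = c · leadLast D` (transport equation `(★)_{D-1}`, then `q_D`-integration with the
boundary condition `a_{D-1}|_{q_D = 0} = 0`). [folklore] -/
theorem core_step_last : ∀ {D : ℤ} (c : ℝ) (a : ℤ → R), 4 ≤ D →
    (∀ z, a z ∈ supported ℝ (Sum.inl '' Set.Icc (0 : ℤ) D)) →
    a 0 = C c * lead0 D → a D = C c * leadD D → a (D - 2) = C c * leadMid D (D - 2) →
    cub (X (Sum.inl 0)) (X (Sum.inl 1)) * shift (pderiv (Sum.inl 0) (a (D - 2))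
      + pderiv (Sum.inl (D - 2)) (a 0)) = cub (X (Sum.inl (D + 1))) (X (Sum.inl D))
      * (pderiv (Sum.inl D) (a (D - 1)) + pderiv (Sum.inl (D - 1)) (a D)) →
    killVar (Sum.inl D) (a (D - 1)) = 0 → a (D - 1) = C c * leadLast D := by
  intro D c a hD _ h0 hDD hmid hstar hkill
  rw [map_add, hmid, h0, hDD, last_e1 hD c, last_e2 hD c, last_e3 hD c] at hstar
  have hG : pderiv (Sum.inl D) (a (D - 1)) = C c * (cub (X (Sum.inl 0)) (X (Sum.inl 1))
      * prodsq (Finset.Ico 1 (D - 2)) * gam (D - 2) * gam (D - 1)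
      * (C ((4 * D - 2 : ℤ) : ℝ) * gam (D - 2) - C ((4 * D - 6 : ℤ) : ℝ) * gam (D - 1))) := by
    apply mul_left_cancel₀ (cub_inl_ne_zero (show D + 1 ≠ D by omega))
    rw [prodsq_Ico_bot (show (1 : ℤ) < D - 2 by omega)] at hstar ⊢
    simp only [map_intCast, show (1 : ℤ) + 1 = 2 by omega] at hstar ⊢
    push_cast at hstar ⊢
    linear_combination -hstar
  exact eq_of_pderiv_eq_of_killVar_eq (hG.trans (last_e4 hD c).symm)
    (hkill.trans (last_k4 D c).symm)

/-! ### The clash at `y = D` (`D ≥ 4`) -/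

/-- `S ∂_0 (c · leadLast D)`. [folklore] -/
private theorem clash_f1 {D : ℤ} (hD : 4 ≤ D) (c : ℝ) :
    shift (pderiv (Sum.inl 0) (C c * leadLast D))
      = C c * (3 * gam 1 ^ 2 * gam (D - 1) * prodsq (Finset.Ico 2 (D - 1)) * X (Sum.inl (D + 1))
          * (C ((4 * D - 2 : ℤ) : ℝ) * X (Sum.inl (D - 1)) * X (Sum.inl D)
              - C ((2 * D - 1 : ℤ) : ℝ) * X (Sum.inl (D - 1)) * X (Sum.inl (D + 1))
              - C ((8 * D - 8 : ℤ) : ℝ) * X (Sum.inl D) ^ 2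
              + C ((6 * D - 7 : ℤ) : ℝ) * X (Sum.inl D) * X (Sum.inl (D + 1))
              - C (((4 * D - 6 : ℤ) : ℝ) / 3) * X (Sum.inl (D + 1)) ^ 2)) := by
  unfold leadLast
  simp only [pderiv_mul, pderiv_C, map_sub, map_add, pderiv_pow, pd_cub, pderiv_X_self,
    pd_X_ne (show (1 : ℤ) ≠ 0 by omega), pd_X_ne (show D ≠ 0 by omega),
    pd_X_ne (show D - 1 ≠ 0 by omega), pd_X_ne (show D - 2 ≠ 0 by omega),
    pd_gam_ne (show D - 2 ≠ 0 by omega) (show D - 2 + 1 ≠ 0 by omega),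
    pderiv_inl_prodsq_eq_zero (show (0 : ℤ) ∉ Finset.Ico 1 (D - 2) by simp)
      (show (0 : ℤ) - 1 ∉ Finset.Ico 1 (D - 2) by simp),
    mul_zero, zero_mul, add_zero, mul_one]
  simp only [map_mul, map_sub, map_add, map_pow, map_ofNat, map_zero, shift_C, shift_X_inl,
    shift_prodsq_Ico, gam, cub, show D - 2 + 1 = D - 1 by omega, show D - 1 + 1 = D by omega,
    show (0 : ℤ) + 1 = 1 by omega, show (1 : ℤ) + 1 = 2 by omega]
  ring

/-- `S ∂_{D-1} (c · lead0 D)`. [folklore] -/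
private theorem clash_f2 {D : ℤ} (hD : 4 ≤ D) (c : ℝ) :
    shift (pderiv (Sum.inl (D - 1)) (C c * lead0 D))
      = C c * (prodsq (Finset.Ico 1 (D - 1)) * gam (D - 1)
          * ((6 * X (Sum.inl (D + 1)) * X (Sum.inl D) - 3 * X (Sum.inl (D + 1)) ^ 2) * gam (D - 1)
              - 2 * cub (X (Sum.inl (D + 1))) (X (Sum.inl D)))) := by
  have hs : prodsq (Finset.Ico 0 (D - 1)) = prodsq (Finset.Ico 0 (D - 2)) * gam (D - 2) ^ 2 := by
    rw [show D - 1 = D - 2 + 1 by omega, prodsq_Ico_succ (by omega)]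
  unfold lead0
  rw [hs]
  simp only [pderiv_mul, pderiv_C, pderiv_pow, pd_cub, pderiv_X_self,
    pd_X_ne (show D ≠ D - 1 by omega), pd_gam_succ (show D - 1 = D - 2 + 1 by omega),
    pderiv_inl_prodsq_eq_zero (show D - 1 ∉ Finset.Ico 0 (D - 2) by simp)
      (show D - 1 - 1 ∉ Finset.Ico 0 (D - 2) by simp only [Finset.mem_Ico]; omega),
    mul_zero, zero_mul, zero_add, mul_one]
  simp only [map_mul, map_sub, map_add, map_neg, map_pow, map_ofNat, map_natCast, map_one,
    shift_X_inl, shift_C, shift_prodsq_Ico, gam, cub, show D - 2 + 1 = D - 1 by omega,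
    show D - 1 + 1 = D by omega, show (0 : ℤ) + 1 = 1 by omega]
  push_cast
  ring

/-- `∂_D (c · leadD D)`. [folklore] -/
private theorem clash_f3 {D : ℤ} (hD : 4 ≤ D) (c : ℝ) :
    pderiv (Sum.inl D) (C c * leadD D)
      = C c * (2 * cub (X (Sum.inl 0)) (X (Sum.inl 1)) * prodsq (Finset.Ico 1 (D - 1))
          * gam (D - 1)) := by
  have hs : prodsq (Finset.Ico 1 D) = prodsq (Finset.Ico 1 (D - 1)) * gam (D - 1) ^ 2 := by
    rw [← prodsq_Ico_succ (show (1 : ℤ) ≤ D - 1 by omega), sub_add_cancel]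
  unfold leadD
  rw [hs]
  simp only [pderiv_mul, pderiv_C, map_neg, pderiv_pow, pd_cub,
    pd_X_ne (show (0 : ℤ) ≠ D by omega), pd_X_ne (show (1 : ℤ) ≠ D by omega),
    pd_gam_succ (show D = D - 1 + 1 by omega),
    pderiv_inl_prodsq_eq_zero (show D ∉ Finset.Ico 1 (D - 1) by simp)
      (show D - 1 ∉ Finset.Ico 1 (D - 1) by simp),
    mul_zero, zero_mul, add_zero, zero_add]
  push_cast
  ring

/-- THE CLASH (`D ≥ 4`): with `a_0, a_D, a_{D-1}` of the forced closed forms, the last transport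
equation `(★)_D` fails unless `c = 0` — its residual is
`2D·c·Φ_L·γ_{D-1}·Π_{[1,D-1)}·q_{D+1}·clashQuad D`. [folklore] -/
theorem core_clash_of_last : ∀ {D : ℤ} (c : ℝ) (a : ℤ → R), 4 ≤ D → a 0 = C c * lead0 D →
    a D = C c * leadD D → a (D - 1) = C c * leadLast D →
    cub (X (Sum.inl 0)) (X (Sum.inl 1)) * shift (pderiv (Sum.inl 0) (a (D - 1))
      + pderiv (Sum.inl (D - 1)) (a 0)) = cub (X (Sum.inl (D + 1))) (X (Sum.inl D))
      * (pderiv (Sum.inl D) (a D) + pderiv (Sum.inl D) (a D)) → c = 0 := by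
  intro D c a hD h0 hDD hlast hstar
  rw [map_add, hlast, h0, hDD, clash_f1 hD c, clash_f2 hD c, clash_f3 hD c] at hstar
  have key : C c * (cub (X (Sum.inl 0)) (X (Sum.inl 1)) * gam (D - 1)
      * prodsq (Finset.Ico 1 (D - 1)) * (C ((2 * D : ℤ) : ℝ) * X (Sum.inl (D + 1))
      * clashQuad D)) = 0 := by
    rw [prodsq_Ico_bot (show (1 : ℤ) < D - 1 by omega)] at hstar ⊢
    rw [C_div_three] at hstar
    simp only [gam, cub, clashQuad, map_intCast, show (1 : ℤ) + 1 = 2 by omega,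
      show D - 1 + 1 = D by omega] at hstar ⊢
    push_cast at hstar ⊢
    linear_combination hstar + (C c * (X (Sum.inl 0) ^ 3 - 3 * X (Sum.inl 0) ^ 2 * X (Sum.inl 1)
      + 3 * X (Sum.inl 0) * X (Sum.inl 1) ^ 2) * (X (Sum.inl 1) - X (Sum.inl 2)) ^ 2
      * (X (Sum.inl (D - 1)) - X (Sum.inl D)) * prodsq (Finset.Ico 2 (D - 1))
      * X (Sum.inl (D + 1)) ^ 3 * (4 * (D : R) - 6)) * C13_mul_three
  have hne : cub (X (Sum.inl 0)) (X (Sum.inl 1)) * gam (D - 1) * prodsq (Finset.Ico 1 (D - 1))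
      * (C ((2 * D : ℤ) : ℝ) * X (Sum.inl (D + 1)) * clashQuad D) ≠ 0 := by
    refine mul_ne_zero (mul_ne_zero (mul_ne_zero (cub_inl_ne_zero (by omega)) (gam_ne_zero _))
      (prodsq_ne_zero _)) (mul_ne_zero (mul_ne_zero ?_ (X_ne_zero _)) (clashQuad_ne_zero D))
    exact C_eq_zero.not.mpr (by exact_mod_cast (show (2 * D : ℤ) ≠ 0 by omega))
  simpa using (mul_eq_zero.mp key).resolve_right hne

/-! ### Span one -/

/-- Span `D = 1`: the transport equation `(★)_1` already fails unless `c = 0`. [folklore] -/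
theorem core_clash_one : ∀ (c : ℝ) (a : ℤ → R),
    (∀ y, a y ∈ supported ℝ (Sum.inl '' Set.Icc (0 : ℤ) 1)) → (∀ y, y < 0 ∨ 1 < y → a y = 0) →
    a 0 = C c * lead0 1 → a 1 = C c * leadD 1 →
    (∀ y : ℤ, cub (X (Sum.inl 0)) (X (Sum.inl 1)) * shift (pderiv (Sum.inl 0) (a (y - 1))
      + pderiv (Sum.inl (y - 1)) (a 0)) = cub (X (Sum.inl (1 + 1))) (X (Sum.inl 1))
      * (pderiv (Sum.inl 1) (a y) + pderiv (Sum.inl y) (a 1))) →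
    (∀ y, y ≤ 1 - 1 → killVar (Sum.inl 1) (a y) = 0) → c = 0 := by
  intro c a _ _ h0 h1 hstar _
  have l0 : a 0 = C c * cub (X (Sum.inl 1)) (X (Sum.inl 0)) := by
    rw [h0, lead0, sub_self, Finset.Ico_self, prodsq_empty, mul_one]
  have l1 : a 1 = C c * -cub (X (Sum.inl 0)) (X (Sum.inl 1)) := by
    rw [h1, leadD, Finset.Ico_self, prodsq_empty, mul_one]
  have s1 := hstar 1
  simp only [sub_self, show (1 : ℤ) + 1 = 2 by omega, l0, l1] at s1
  simp only [pderiv_mul, pderiv_C, map_neg, pd_cub, pderiv_X_self,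
    pd_X_ne (show (1 : ℤ) ≠ 0 by omega), pd_X_ne (show (0 : ℤ) ≠ 1 by omega),
    mul_zero, zero_mul, zero_add, mul_one] at s1
  simp only [map_mul, map_add, map_sub, map_pow, map_ofNat, shift_C, shift_X_inl, cub,
    show (0 : ℤ) + 1 = 1 by omega, show (1 : ℤ) + 1 = 2 by omega] at s1
  have key : C c * (12 * X (Sum.inl 0) ^ 3 * X (Sum.inl 1) * X (Sum.inl 2)
      - 6 * X (Sum.inl 0) ^ 3 * X (Sum.inl 2) ^ 2
      - 54 * X (Sum.inl 0) ^ 2 * X (Sum.inl 1) ^ 2 * X (Sum.inl 2)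
      + 36 * X (Sum.inl 0) ^ 2 * X (Sum.inl 1) * X (Sum.inl 2) ^ 2
      - 6 * X (Sum.inl 0) ^ 2 * X (Sum.inl 2) ^ 3
      + 72 * X (Sum.inl 0) * X (Sum.inl 1) ^ 3 * X (Sum.inl 2)
      - 54 * X (Sum.inl 0) * X (Sum.inl 1) ^ 2 * X (Sum.inl 2) ^ 2
      + 12 * X (Sum.inl 0) * X (Sum.inl 1) * X (Sum.inl 2) ^ 3 : R) = 0 := by
    linear_combination s1
  have hne : (12 * X (Sum.inl 0) ^ 3 * X (Sum.inl 1) * X (Sum.inl 2)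
      - 6 * X (Sum.inl 0) ^ 3 * X (Sum.inl 2) ^ 2
      - 54 * X (Sum.inl 0) ^ 2 * X (Sum.inl 1) ^ 2 * X (Sum.inl 2)
      + 36 * X (Sum.inl 0) ^ 2 * X (Sum.inl 1) * X (Sum.inl 2) ^ 2
      - 6 * X (Sum.inl 0) ^ 2 * X (Sum.inl 2) ^ 3
      + 72 * X (Sum.inl 0) * X (Sum.inl 1) ^ 3 * X (Sum.inl 2)
      - 54 * X (Sum.inl 0) * X (Sum.inl 1) ^ 2 * X (Sum.inl 2) ^ 2
      + 12 * X (Sum.inl 0) * X (Sum.inl 1) * X (Sum.inl 2) ^ 3 : R) ≠ 0 := by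
    intro h
    have e := congrArg (MvPolynomial.eval
      (fun v : Var => if v = Sum.inl 0 ∨ v = Sum.inl 2 then (1 : ℝ) else 0)) h
    simp at e
    norm_num at e
  simpa using (mul_eq_zero.mp key).resolve_right hne

end Summit.AtomisticToContinuum.FouriersLaw.Theorems.OddChargeAlgebra

end
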